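import Summits.KontsevichZagierPeriods.KontsevichZagierPeriods.Theses.SymplecticScissors
import Literature.NumberTheory.Transcendental.AyoubPeriodSeries
import Literature.NumberTheory.Transcendental.AyoubPeriodSeriesKernel
import Literature.NumberTheory.Transcendental.AyoubPeriodSeriesPiAlgebraic
import Literature.NumberTheory.Transcendental.AyoubPeriodSeriesLocalizing
import Summits.KontsevichZagierPeriods.KontsevichZagierPeriods.Theorems.UnfoldedStokesStokesGenerationStubSpanToRepsAuxCoeff
import Summits.KontsevichZagierPeriods.KontsevichZagierPeriods.Theorems.SymplecticScissorsTypeAGenerationStubRoomStepCongruence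
import Summits.KontsevichZagierPeriods.KontsevichZagierPeriods.Theorems.SymplecticScissorsTypeAGenerationStubRestrCOneAux
import Mathlib.RingTheory.MvPowerSeries.Rename
import Mathlib.RingTheory.MvPowerSeries.Substitution

/-!
# `TypeAGeneration` (stmt-KontsevichZagierPeriods-18392), line `Sketch`, stub
`stub_interpolationCertificate_of` (W3): THE INTERPOLATION CERTIFICATE (C2)

Registered stub `stub_interpolationCertificate_of` of the crux `TypeAGeneration` (route
SymplecticScissors, line `Sketch` = card stokes-compiler, Ayoub 2015 Conj. 1.1), on top of
`Literature/NumberTheory/Transcendental/AyoubPeriodSeries.lean`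
(`AyoubRel.CSeries = ℂ[[z₀, z₁, …]]`, `AyoubRel.Oan σ = 𝒪_{k-alg}(𝔻̄^∞)`, `AyoubRel.pdz i = ∂/∂zᵢ`,
`AyoubRel.restrC i c = (·)|_{zᵢ = c}`,
`AyoubRel.relAC i G = ∂ᵢG − G|_{zᵢ=1} + G|_{zᵢ=0}`) and the landed face-map lemmas of
`SymplecticScissorsTypeAGenerationStub{RoomStepCongruence,RestrCOneAux}.lean`.

**Statement.** Given the derivation rules of `∂/∂zᵢ` (registered separately as `stub_pdzCalculus`
and taken here as a hypothesis), let `W ∈ 𝒪_{k-alg}(𝔻̄^∞)` be free of `z_j` (`i ≠ j`) with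
`W|_{zᵢ=1} = W|_{zᵢ=0} =: W₀`, and let `V ∈ 𝒪_{k-alg}(𝔻̄^∞)` invert the straight-line interpolant
`W̃ = W₀ + z_j (W − W₀)`. Then the logarithmic derivative `∂ᵢW · V|_{z_j=1}` (`= W′/W`) lies in the
`k`-span of the type (a) elements.

**Proof** (algebra in the commutative ring `ℂ[[z]]`). Put `Ω = z_j ∂ᵢW · V` (`= ∂ᵢW̃ · V`) and
`Λ = (W − W₀) V` (`= ∂_jW̃ · V`).
* closedness `∂_jΩ = ∂ᵢΛ`: differentiating `W̃ V = 1` gives `z_j ∂ᵢW V + W̃ ∂ᵢV = 0` and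
  `(W − W₀) V + W̃ ∂_jV = 0`, whence `z_j ∂ᵢW ∂_jV = (W − W₀) ∂ᵢV` (cancel the unit `W̃`);
* faces: `Ω|_{z_j=1} = ∂ᵢW · V|_{z_j=1}` (`∂ᵢW` is free of `z_j`; product rule of the face map on
  absolutely summable series), `Ω|_{z_j=0} = 0`, `Λ|_{zᵢ=1} = (W|_{zᵢ=1} − W₀) V|_{zᵢ=1} = 0`,
  `Λ|_{zᵢ=0} = 0` (`zᵢ ∣ W − W₀`);
* hence `relAC i Λ − relAC j Ω = ∂ᵢW · V|_{z_j=1}`, and `Ω, Λ ∈ 𝒪_{k-alg}(𝔻̄^∞)`.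

References: Ayoub 2015 Rem. 1.5; Fresán 2024 Rem. 3.7.
-/

noncomputable section

-- `Summit.KontsevichZagierPeriods.KontsevichZagierPeriods.…` is the tree's mandated layout (single-conjunct summit).
set_option linter.dupNamespace false

namespace Summit.KontsevichZagierPeriods.KontsevichZagierPeriods.TypeAGenerationLine

open Finsupp MvPowerSeries
open Literature.NumberTheory.Transcendental
open Literature.NumberTheory.Transcendental.AyoubRel
open Summit.KontsevichZagierPeriods.KontsevichZagierPeriods.Theses.SymplecticScissors (TypeAGeneration)

/-! ## Series free of a variable: the partial derivative vanishes, the face maps are the identity -/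

section Free

variable {G : CSeries} {l : ℕ}

/-- A series free of `z_l` has no coefficient at an exponent involving `z_l`. [folklore] -/
private theorem w3_coeff_eq_zero_of_not_usesVar (h : ¬ UsesVar G l) {a : ℕ →₀ ℕ} (ha : a l ≠ 0) :
    coeff a G = 0 := by
  by_contra hne
  exact h ⟨a, ha, hne⟩

/-- `coeff_a (G|_{z_l=0}) = [a_l = 0] coeff_a G`. [folklore] -/
private theorem w3_coeff_restrC_zero (l : ℕ) (G : CSeries) (a : ℕ →₀ ℕ) :
    coeff a (restrC l 0 G) = if a l = 0 then coeff a G else 0 := by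
  rw [StokesGenerationLine.coeff_restrC]
  split_ifs with ha
  · rw [tsum_eq_single 0 fun n hn => by rw [zero_pow hn, mul_zero], pow_zero, mul_one,
      single_zero, add_zero]
  · rfl

/-- `∂_l G = 0` for `G` free of `z_l`. [folklore] -/
private theorem w3_pdz_eq_zero_of_not_usesVar (h : ¬ UsesVar G l) : pdz l G = 0 := by
  ext a
  rw [StokesGenerationLine.coeff_pdz, map_zero, w3_coeff_eq_zero_of_not_usesVar h, mul_zero]
  rw [Finsupp.add_apply, single_eq_same]
  exact Nat.succ_ne_zero _

/-- `∂ᵢ` does not introduce variables. [folklore] -/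
private theorem w3_not_usesVar_pdz (h : ¬ UsesVar G l) (i : ℕ) : ¬ UsesVar (pdz i G) l := by
  rintro ⟨a, ha, hne⟩
  refine hne ?_
  rw [StokesGenerationLine.coeff_pdz, w3_coeff_eq_zero_of_not_usesVar h, mul_zero]
  rw [Finsupp.add_apply]
  exact fun h0 => ha (Nat.eq_zero_of_add_eq_zero_right h0)

/-- `G|_{z_l=1} = G` for `G` free of `z_l`. [folklore] -/
private theorem w3_restrC_one_of_not_usesVar (h : ¬ UsesVar G l) : restrC l 1 G = G := by
  ext a
  rw [s4_coeff_restrC_one]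
  split_ifs with ha
  · rw [tsum_eq_single 0 fun n hn => ?_]
    · rw [single_zero, add_zero]
    · refine w3_coeff_eq_zero_of_not_usesVar h ?_
      rwa [Finsupp.add_apply, ha, single_eq_same, zero_add]
  · exact (w3_coeff_eq_zero_of_not_usesVar h ha).symm

/-- `G|_{z_l=0}` is free of `z_l`. [folklore] -/
private theorem w3_not_usesVar_restrC_zero_self (l : ℕ) (G : CSeries) :
    ¬ UsesVar (restrC l 0 G) l := by
  rintro ⟨a, ha, hne⟩
  rw [w3_coeff_restrC_zero, if_neg ha] at hne
  exact hne rfl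

/-- `(·)|_{zᵢ=0}` does not introduce variables. [folklore] -/
private theorem w3_not_usesVar_restrC_zero (h : ¬ UsesVar G l) (i : ℕ) :
    ¬ UsesVar (restrC i 0 G) l := by
  rintro ⟨a, ha, hne⟩
  rw [w3_coeff_restrC_zero] at hne
  split_ifs at hne with hai
  · exact hne (w3_coeff_eq_zero_of_not_usesVar h ha)
  · exact hne rfl

/-- `zᵢ ∣ W − W|_{zᵢ=0}`. [folklore] -/
private theorem w3_X_dvd_sub_restrC_zero (i : ℕ) (W : CSeries) :
    (X i : CSeries) ∣ W - restrC i 0 W := by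
  rw [X_dvd_iff]
  intro m hm
  rw [map_sub, w3_coeff_restrC_zero, if_pos hm, sub_self]

end Free

/-! ## Registered form -/

/-- W3 — THE INTERPOLATION CERTIFICATE (C2), given the derivation rules W1: for
`W ∈ 𝒪_{k-alg}(𝔻̄^∞)` free of `z_j` with `W|_{zᵢ=1} = W|_{zᵢ=0}`, and `V ∈ 𝒪_{k-alg}(𝔻̄^∞)`
inverting the straight-line interpolant `W̃ = W|_{zᵢ=0} + z_j (W − W|_{zᵢ=0})` (admissibility as
data), the logarithmic derivative `∂ᵢW · V|_{z_j=1}` (`= W′/W`) lies in the `k`-span of type (a):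
with `Ω = ∂ᵢW̃ · V = z_j ∂ᵢW V`, `Λ = ∂_jW̃ · V = (W − W|₀) V` one has `∂_jΩ = ∂ᵢΛ` (from `W̃V = 1`)
and `relAC j Ω − relAC i Λ = −∂ᵢW · V|_{z_j=1}`. [cite: Ayoub2015, Rem. 1.5] -/
theorem stub_interpolationCertificate_of :
    (∀ (i : ℕ) (F G : CSeries) (c : ℂ),
      pdz i (c • F + G) = c • pdz i F + pdz i G ∧
      pdz i (F * G) = pdz i F * G + F * pdz i G ∧
      (∀ j : ℕ, pdz i (pdz j F) = pdz j (pdz i F)) ∧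
      (∀ l : ℕ, pdz i (X l : CSeries) = if l = i then 1 else 0) ∧
      pdz i (C c : CSeries) = 0) →
    ∀ (k : Type) [Field k] [CharZero k] (σ : k →+* ℂ) (i j : ℕ), i ≠ j →
      ∀ (W V : CSeries), W ∈ Oan σ → V ∈ Oan σ → ¬ UsesVar W j →
        pdz i W ∈ Oan σ → restrC i 0 W ∈ Oan σ →
        (restrC i 0 W + X j * (W - restrC i 0 W)) * V = 1 →
        restrC i 1 W = restrC i 0 W →
        pdz i W * restrC j 1 V ∈ kSpan σ {x : CSeries | ∃ G ∈ Oan σ, ∃ n : ℕ, x = relAC n G} := by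
  intro hW1 k _ _ σ i j hij W V hW hV hWj hpdzW hW0 hunit hloop
  -- the derivation rules of `∂`
  have hadd : ∀ (l : ℕ) (F G : CSeries), pdz l (F + G) = pdz l F + pdz l G := fun l F G => by
    have h := (hW1 l F G 1).1
    rwa [one_smul, one_smul] at h
  have hmul : ∀ (l : ℕ) (F G : CSeries), pdz l (F * G) = pdz l F * G + F * pdz l G :=
    fun l F G => (hW1 l F G 0).2.1
  have hsub : ∀ (l : ℕ) (F G : CSeries), pdz l (F - G) = pdz l F - pdz l G := fun l F G => by
    rw [sub_eq_add_neg, hadd, ← neg_one_smul ℂ G, pdz_smul, neg_one_smul, ← sub_eq_add_neg]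
  have hX : ∀ l l' : ℕ, pdz l (X l' : CSeries) = if l' = l then 1 else 0 :=
    fun l l' => (hW1 l 0 0 0).2.2.2.1 l'
  have hone : ∀ l : ℕ, pdz l (1 : CSeries) = 0 := fun l => by
    have h := (hW1 l 0 0 1).2.2.2.2
    rwa [map_one] at h
  -- `W₀ = W|_{zᵢ=0}` is free of `zᵢ` and of `z_j`
  set W₀ := restrC i 0 W
  have hW₀i : ¬ UsesVar W₀ i := w3_not_usesVar_restrC_zero_self i W
  have hW₀j : ¬ UsesVar W₀ j := w3_not_usesVar_restrC_zero hWj i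
  have hpdzjW : pdz j W = 0 := w3_pdz_eq_zero_of_not_usesVar hWj
  have hpdziW₀ : pdz i W₀ = 0 := w3_pdz_eq_zero_of_not_usesVar hW₀i
  have hpdzjW₀ : pdz j W₀ = 0 := w3_pdz_eq_zero_of_not_usesVar hW₀j
  have hpdzji : pdz j (pdz i W) = 0 := by rw [(hW1 j W 0 0).2.2.1 i, hpdzjW, pdz_zero]
  -- (1) the derivatives of the interpolant `W̃ = W₀ + z_j (W − W₀)`
  set Wt := W₀ + X j * (W - W₀) with hWtdef
  have h1i : pdz i Wt = X j * pdz i W := by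
    rw [hWtdef, hadd, hmul, hsub, hX, if_neg hij.symm, hpdziW₀, zero_mul, zero_add, zero_add,
      sub_zero]
  have h1j : pdz j Wt = W - W₀ := by
    rw [hWtdef, hadd, hmul, hsub, hX, if_pos rfl, hpdzjW₀, hpdzjW, zero_add, one_mul, sub_zero,
      mul_zero, add_zero]
  -- differentiate `W̃ V = 1`
  have hEi : X j * pdz i W * V + Wt * pdz i V = 0 := by
    have h := congrArg (pdz i) hunit
    rwa [hmul, h1i, hone] at h
  have hEj : (W - W₀) * V + Wt * pdz j V = 0 := by
    have h := congrArg (pdz j) hunit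
    rwa [hmul, h1j, hone] at h
  -- (2) closedness `∂_j Ω = ∂ᵢ Λ`
  have hkey : X j * pdz i W * pdz j V = (W - W₀) * pdz i V := by
    linear_combination (pdz j V * Wt) * hEi - (pdz i V * Wt) * hEj -
      (X j * pdz i W * pdz j V - (W - W₀) * pdz i V) * hunit
  have h2 : pdz j (X j * pdz i W * V) = pdz i ((W - W₀) * V) := by
    have e1 : pdz j (X j * pdz i W * V) = pdz i W * V + X j * pdz i W * pdz j V := by
      rw [hmul, hmul, hX, if_pos rfl, one_mul, hpdzji, mul_zero, add_zero]
    have e2 : pdz i ((W - W₀) * V) = pdz i W * V + (W - W₀) * pdz i V := by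
      rw [hmul, hsub, hpdziW₀, sub_zero]
    rw [e1, e2, hkey]
  -- (3) the four faces
  have hsV := summable_norm_coeff_of_mem_Oan σ hV
  have h3a : restrC j 1 (X j * pdz i W * V) = pdz i W * restrC j 1 V := by
    rw [mul_assoc, s2_restrC_one_X_mul, s4_restrC_mul (summable_norm_coeff_of_mem_Oan σ hpdzW) hsV,
      w3_restrC_one_of_not_usesVar (w3_not_usesVar_pdz hWj i)]
  have h3b : restrC j 0 (X j * pdz i W * V) = 0 := by
    rw [mul_assoc, s2_restrC_zero_X_mul]
  have h3c : restrC i 1 ((W - W₀) * V) = 0 := by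
    rw [s4_restrC_mul (summable_norm_coeff_of_mem_Oan σ (sub_mem_Oan σ hW hW0)) hsV,
      sub_eq_add_neg, s4_restrC_add i (summable_norm_coeff_of_mem_Oan σ hW)
        (summable_norm_coeff_of_mem_Oan σ (neg_mem_Oan σ hW0)),
      hloop, ← neg_one_smul ℂ W₀, restrC_smul, w3_restrC_one_of_not_usesVar hW₀i, neg_one_smul,
      add_neg_cancel, zero_mul]
  have h3d : restrC i 0 ((W - W₀) * V) = 0 := by
    obtain ⟨Q, hQ⟩ := w3_X_dvd_sub_restrC_zero i W
    rw [hQ, mul_assoc, s2_restrC_zero_X_mul]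
  -- (4) assembly of the certificate
  have h4 : pdz i W * restrC j 1 V = relAC i ((W - W₀) * V) - relAC j (X j * pdz i W * V) := by
    rw [relAC, relAC, h2, h3a, h3b, h3c, h3d]
    abel
  -- (5) membership
  have hΩ : X j * pdz i W * V ∈ Oan σ := mul_mem_Oan σ (mul_mem_Oan σ (s2_X_mem_Oan σ j) hpdzW) hV
  have hΛ : (W - W₀) * V ∈ Oan σ := mul_mem_Oan σ (sub_mem_Oan σ hW hW0) hV
  rw [h4]
  exact kSpan_sub σ (subset_kSpan σ _ ⟨_, hΛ, i, rfl⟩) (subset_kSpan σ _ ⟨_, hΩ, j, rfl⟩)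

end Summit.KontsevichZagierPeriods.KontsevichZagierPeriods.TypeAGenerationLine
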